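import Mathlib

/-!
# Route «KPlusLogSqLaw», crux `WeakLifting` (stmt-ValiantsHypothesis-19561) — REAL side of the tridiagonal sector:
# the ENTROPY BALANCE INEQUALITY for pivot-energy chains (all sizes; the analytic core of the crossing-direction law)

HONEST FRAMING.  Helper theorems (`--supports stmt-ValiantsHypothesis-19561 --as helper`), seat val-sym-lift-p1 (g18), cell `pub-symmetroid`,
2026-08-28; pure real analysis, consumed by `…TridiagonalRealStaticUnitCrossingDirection` (this seat).  Setting (seat memo
CROSSING-DIRECTION-liftp1g18.md): at a positive determinant zero `x₀ ≠ 1` of a unit-coefficient static symmetric tridiagonal design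
(continuants `D_k`, currency `StaticTridiagonalRealPotential.pathDet (fun _ => 1) d (fun _ => 1) f`), the kernel vector of the monomial matrix is
`w_i ∝ ± D_i(x₀)·x₀^{−F_i}`; its EDGE ENERGIES `e_k = D_k D_{k+1} x₀^{−2F_k}` (sign = sign of the `k`-th pivot) and VERTEX MASSES
`μ_i = x₀^{d_i} D_i² x₀^{−2F_i} > 0` satisfy `μ_i = e_{i−1} + e_i`, `μ_0 = e_0`, `μ_{m−1} = e_{m−2}`, and `e_k² / (μ_k μ_{k+1}) = x₀^{L_k}`
(`L_k = 2f_k − d_k − d_{k+1}` the edge slope).  The direction in which the zero eigenvalue crosses is the sign of the SLOPE-WEIGHTED ENERGY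
`Σ_k L_k e_k`, and `(log x₀)·Σ_k L_k e_k = Σ_k e_k log(e_k²/(μ_kμ_{k+1})) = −Σ_i μ_i·H(e_{i−1}/μ_i)` (`H` = Mathlib's `Real.binEntropy`,
extended by `Real.log = log|·|`): vertices between two positive energies contribute `−Δ(e_{i−1}, e_i) < 0`
(`Δ(p,q) = (p+q)log(p+q) − p log p − q log q`), the two vertices of a negative energy `−c` (flanked by `a, b > c`) contribute
`+Δ(a−c, c) + Δ(b−c, c)`.  Proved here, for arbitrary real chains (no matrices):
* `mul_log_incr_lt` — strict increment monotonicity of `x log x` (from Mathlib's strict convexity); `delta_pos`, `delta_lt` — the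
  «cost < gain» comparison `Δ(a−c, c) < Δ(x, a)` whenever `0 < c < x`, `c < a`;
* `vertexTerm_eq_binEntropy` — the vertex term is `(p+q)·binEntropy(p/(p+q))`;
* **ENTROPY BALANCE INEQUALITY** (`entropyBalance_pos`, all lengths): if every negative energy `e_k = −c` has second neighbours with
  `c < e_{k−2}`, `c < e_{k+2}` (this is what RECESSIVE flanking edges give) and no two negative energies are exactly three edges apart, then
  `Σ_{interior i} [μ_i log μ_i − e_{i−1} log|e_{i−1}| − e_i log|e_i|] > 0` — each negative edge is paid for by the two positive vertices
  next to its `N`/`J` vertices; `entropyBalance_binEntropy_pos` is the same in entropy form;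
* `edge_sum_eq_vertex_sum` — the regrouping identity EDGE FORM = VERTEX FORM.
The separation hypothesis is SHARP (memo §3: an admissible chain with pattern `A N J A N J A`, `m = 9`, has negative balance), so the
inequality is not a general law of recessive chains.  Nothing here is an upper law for the register (α NO MOVER); nothing bears on
`WeakLifting` / `TropicalB` (stmt-19771) in their windows, Conjecture B, the Door-A registers, `MatrixDescartes` (stmt-18050) or VP ≠ VNP.
[this seat; folklore: convexity of `x log x`, binary entropy]
-/

-- `Summit.ValiantsHypothesis.ValiantsHypothesis.…` repeats a component by the D-0017 layout (single-conjunct summit); the name is mandated.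
set_option linter.dupNamespace false
set_option autoImplicit false

namespace Summit.ValiantsHypothesis.ValiantsHypothesis.Theorems.KPlusLogSqLaw
namespace StaticTridiagonalRealUnit

open Real Finset

/-! ### 1. Increments of `x log x` -/

/-- **strict increment monotonicity of `x log x`**: for `0 ≤ p < p'` and `q > 0`,
`(p+q) log(p+q) − p log p < (p'+q) log(p'+q) − p' log p'`. [folklore: strict convexity of `x log x`] -/
theorem mul_log_incr_lt {p p' q : ℝ} (hp : 0 ≤ p) (hpp : p < p') (hq : 0 < q) :
    (p + q) * log (p + q) - p * log p < (p' + q) * log (p' + q) - p' * log p' := by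
  have hg := Real.strictConvexOn_mul_log
  have h1 := hg.secant_strict_mono_aux2 (x := p) (y := p + q) (z := p' + q)
    (Set.mem_Ici.2 hp) (Set.mem_Ici.2 (by linarith)) (by linarith) (by linarith)
  have h2 := hg.secant_strict_mono_aux3 (x := p) (y := p') (z := p' + q)
    (Set.mem_Ici.2 hp) (Set.mem_Ici.2 (by linarith)) hpp (by linarith)
  have h := h1.trans h2
  rw [show p + q - p = q by ring, show p' + q - p' = q by ring, div_lt_div_iff_of_pos_right hq] at h
  linarith

/-- `Δ(p,q) = (p+q)log(p+q) − p log p − q log q > 0` for `p, q > 0` (strict superadditivity of `x log x`). [folklore] -/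
theorem delta_pos {p q : ℝ} (hp : 0 < p) (hq : 0 < q) :
    0 < (p + q) * log (p + q) - p * log p - q * log q := by
  have h := mul_log_incr_lt (p := 0) (p' := p) (q := q) le_rfl hp hq
  simp only [zero_add, zero_mul, sub_zero] at h
  linarith

/-- **cost < gain**: `Δ(a−c, c) < Δ(x, a)` whenever `0 < c < x` and `c < a` — the entropy cost `a·H(c/a)` of splitting a positive energy `a`
at a negative neighbour `−c` is smaller than the gain of any positive vertex `(x, a)` with `x > c`. [this file] -/
theorem delta_lt {a c x : ℝ} (hc : 0 < c) (hca : c < a) (hcx : c < x) :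
    a * log a - (a - c) * log (a - c) - c * log c < (x + a) * log (x + a) - x * log x - a * log a := by
  have h1 := mul_log_incr_lt (p := c) (p' := x) (q := a - c) hc.le hcx (by linarith)
  have h2 := mul_log_incr_lt (p := a - c) (p' := a) (q := x) (by linarith) (by linarith) (by linarith)
  rw [show c + (a - c) = a by ring] at h1
  rw [show a - c + x = x + (a - c) by ring, show a + x = x + a by ring] at h2
  linarith

/-! ### 2. The vertex term in entropy form -/

/-- the vertex term of a vertex with incident energies `p, q` (mass `p + q`) is `(p+q)·binEntropy(p/(p+q))`
(`Real.log` is `log |·|`, so negative energies are covered). [this file] -/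
theorem vertexTerm_eq_binEntropy {p q : ℝ} (hp : p ≠ 0) (hq : q ≠ 0) (hpq : p + q ≠ 0) :
    (p + q) * binEntropy (p / (p + q)) = (p + q) * log (p + q) - p * log p - q * log q := by
  unfold binEntropy
  have e1 : 1 - p / (p + q) = q / (p + q) := by field_simp; ring
  rw [e1, log_inv, log_inv, log_div hp hpq, log_div hq hpq]
  field_simp
  ring

/-! ### 3. The entropy balance inequality -/

/-- **ENTROPY BALANCE INEQUALITY (all lengths).**  A chain of real edge energies `e 0, …, e n` (`n ≥ 1`; vertices `0, …, n+1`, vertex `j+1`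
carrying `e j` and `e (j+1)`) with positive end energy `e n`, positive vertex masses `e j + e (j+1)`, nonzero energies, such that every negative
energy `e k = −c` sits at `2 ≤ k ≤ n − 2` with `c < e (k−2)` and `c < e (k+2)`, and no two negative energies are exactly three edges apart,
has positive vertex sum `Σ_{j<n} [(e j + e (j+1)) log(e j + e (j+1)) − e j log|e j| − e (j+1) log|e (j+1)|] > 0`. [this file] -/
theorem entropyBalance_pos (n : ℕ) (e : ℕ → ℝ) (hn : 1 ≤ n) (hend : 0 < e n)
    (hμ : ∀ j, j < n → 0 < e j + e (j + 1)) (hne : ∀ k, k ≤ n → e k ≠ 0)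
    (hflank : ∀ k, k ≤ n → e k < 0 → 2 ≤ k ∧ k + 2 ≤ n ∧ -e k < e (k - 2) ∧ -e k < e (k + 2))
    (hsep : ∀ k, k + 3 ≤ n → e k < 0 → 0 < e (k + 3)) :
    0 < ∑ j ∈ range n, ((e j + e (j + 1)) * log (e j + e (j + 1)) - e j * log (e j) - e (j + 1) * log (e (j + 1))) := by
  induction n using Nat.strong_induction_on with
  | _ n ih =>
  -- the last-but-one energy is positive
  have hn1 : 0 < e (n - 1) := by
    rcases (hne (n - 1) (by omega)).lt_or_gt with h | h
    · exact absurd (hflank (n - 1) (by omega) h).2.1 (by omega)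
    · exact h
  rcases Nat.lt_or_ge n 2 with hn2 | hn2
  · -- n = 1 : one interior vertex with two positive energies
    obtain rfl : n = 1 := by omega
    rw [sum_range_one]
    simpa using delta_pos (p := e 0) (q := e 1) (by simpa using hn1) hend
  · rcases (hne (n - 2) (by omega)).lt_or_gt with hneg | hpos
    · -- e (n-2) = -c < 0 : peel the last four vertices
      obtain ⟨hk2, -, hl, hr⟩ := hflank (n - 2) (by omega) hneg
      obtain ⟨n', rfl⟩ : ∃ n', n = n' + 4 := ⟨n - 4, by omega⟩
      simp only [show n' + 4 - 2 = n' + 2 by omega, show n' + 2 - 2 = n' by omega,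
        show n' + 2 + 2 = n' + 4 by omega, show n' + 4 - 1 = n' + 3 by omega] at hneg hl hr hn1
      have ha : -e (n' + 2) < e (n' + 1) := by
        have := hμ (n' + 1) (by omega); rw [show n' + 1 + 1 = n' + 2 by omega] at this; linarith
      have hb : -e (n' + 2) < e (n' + 3) := by
        have := hμ (n' + 2) (by omega); rw [show n' + 2 + 1 = n' + 3 by omega] at this; linarith
      set c := -e (n' + 2) with hc
      have hc0 : 0 < c := by linarith
      have hx : 0 < e n' := by linarith
      have hea : e (n' + 2) = -c := by rw [hc, neg_neg]
      -- the four peeled vertex terms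
      rw [sum_range_succ, sum_range_succ, sum_range_succ, sum_range_succ]
      have gainL := delta_lt (a := e (n' + 1)) (c := c) (x := e n') hc0 ha hl
      have gainR := delta_lt (a := e (n' + 3)) (c := c) (x := e (n' + 4)) hc0 hb hr
      have hlogc : log (e (n' + 2)) = log c := by rw [hea, log_neg_eq_log]
      -- rewrite the N-vertex and J-vertex terms
      have tN : (e (n' + 1) + e (n' + 1 + 1)) * log (e (n' + 1) + e (n' + 1 + 1)) - e (n' + 1) * log (e (n' + 1)) -
          e (n' + 1 + 1) * log (e (n' + 1 + 1)) =
          -(e (n' + 1) * log (e (n' + 1)) - (e (n' + 1) - c) * log (e (n' + 1) - c) - c * log c) := by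
        rw [show n' + 1 + 1 = n' + 2 by omega, hlogc, hea, ← sub_eq_add_neg]; ring
      have tJ : (e (n' + 2) + e (n' + 2 + 1)) * log (e (n' + 2) + e (n' + 2 + 1)) - e (n' + 2) * log (e (n' + 2)) -
          e (n' + 2 + 1) * log (e (n' + 2 + 1)) =
          -(e (n' + 3) * log (e (n' + 3)) - (e (n' + 3) - c) * log (e (n' + 3) - c) - c * log c) := by
        rw [show n' + 2 + 1 = n' + 3 by omega, hlogc, hea, show -c + e (n' + 3) = e (n' + 3) - c by ring]; ring
      have tA : (e (n' + 3) + e (n' + 3 + 1)) * log (e (n' + 3) + e (n' + 3 + 1)) - e (n' + 3) * log (e (n' + 3)) -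
          e (n' + 3 + 1) * log (e (n' + 3 + 1)) =
          (e (n' + 4) + e (n' + 3)) * log (e (n' + 4) + e (n' + 3)) - e (n' + 4) * log (e (n' + 4)) - e (n' + 3) * log (e (n' + 3)) := by
        rw [show n' + 3 + 1 = n' + 4 by omega, add_comm (e (n' + 3)) (e (n' + 4))]; ring
      rw [tN, tJ, tA]
      -- the prefix
      have hprefix : 0 ≤ ∑ j ∈ range n', ((e j + e (j + 1)) * log (e j + e (j + 1)) - e j * log (e j) -
          e (j + 1) * log (e (j + 1))) := by
        rcases Nat.eq_zero_or_pos n' with h0 | h0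
        · subst h0; simp
        · refine (ih n' (by omega) h0 hx (fun j hj => hμ j (by omega)) (fun k hk => hne k (by omega)) ?_ ?_).le
          · intro k hk hkneg
            obtain ⟨h2, h2n, hl', hr'⟩ := hflank k (by omega) hkneg
            have hk4 : k ≠ n' := by rintro rfl; linarith
            have hk5 : k ≠ n' + 1 := by rintro rfl; linarith
            have hk1 : k + 2 ≤ n' := by
              by_contra hcon
              have := hsep k (by omega) hkneg
              rw [show k + 3 = n' + 2 by omega] at this
              linarith
            exact ⟨h2, hk1, hl', hr'⟩
          · intro k hk hkneg
            exact hsep k (by omega) hkneg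
      linarith
    · -- e (n-2) > 0 : peel the last vertex
      obtain ⟨n', rfl⟩ : ∃ n', n = n' + 1 := ⟨n - 1, by omega⟩
      simp only [Nat.add_sub_cancel] at hn1
      rw [show n' + 1 - 2 = n' - 1 by omega] at hpos
      rw [sum_range_succ]
      have hlast := delta_pos hn1 hend
      have hprefix := ih n' (by omega) (by omega) hn1 (fun j hj => hμ j (by omega)) (fun k hk => hne k (by omega)) ?_ ?_
      · linarith
      · intro k hk hkneg
        obtain ⟨h2, h2n, hl', hr'⟩ := hflank k (by omega) hkneg
        have hk4 : k ≠ n' := by rintro rfl; linarith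
        have hk5 : k ≠ n' - 1 := by rintro rfl; linarith
        exact ⟨h2, by omega, hl', hr'⟩
      · intro k hk hkneg
        exact hsep k (by omega) hkneg

/-- **ENTROPY BALANCE, entropy form**: under the same hypotheses `0 < Σ_{j<n} (e j + e (j+1))·binEntropy(e j/(e j + e (j+1)))`. [this file] -/
theorem entropyBalance_binEntropy_pos (n : ℕ) (e : ℕ → ℝ) (hn : 1 ≤ n) (hend : 0 < e n)
    (hμ : ∀ j, j < n → 0 < e j + e (j + 1)) (hne : ∀ k, k ≤ n → e k ≠ 0)
    (hflank : ∀ k, k ≤ n → e k < 0 → 2 ≤ k ∧ k + 2 ≤ n ∧ -e k < e (k - 2) ∧ -e k < e (k + 2))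
    (hsep : ∀ k, k + 3 ≤ n → e k < 0 → 0 < e (k + 3)) :
    0 < ∑ j ∈ range n, (e j + e (j + 1)) * binEntropy (e j / (e j + e (j + 1))) := by
  have h := entropyBalance_pos n e hn hend hμ hne hflank hsep
  refine h.trans_eq (sum_congr rfl fun j hj => ?_)
  rw [mem_range] at hj
  exact (vertexTerm_eq_binEntropy (hne j hj.le) (hne (j + 1) (by omega)) (hμ j hj).ne').symm

/-! ### 4. Edge form = vertex form -/

/-- **regrouping identity**: with vertex masses `μ 0 = e 0`, `μ i = e (i−1) + e i` (`1 ≤ i ≤ n`), `μ (n+1) = e n`, the EDGE SUM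
`Σ_{k≤n} e k · (log μ k + log μ (k+1) − 2 log|e k|)` equals the VERTEX SUM over the interior vertices. [this file] -/
theorem edge_sum_eq_vertex_sum (n : ℕ) (e μ : ℕ → ℝ)
    (hμ0 : μ 0 = e 0) (hμ : ∀ i, 1 ≤ i → i ≤ n → μ i = e (i - 1) + e i) (hμn : μ (n + 1) = e n) :
    ∑ k ∈ range (n + 1), e k * (log (μ k) + log (μ (k + 1)) - 2 * log (e k)) =
      ∑ j ∈ range n, ((e j + e (j + 1)) * log (e j + e (j + 1)) - e j * log (e j) - e (j + 1) * log (e (j + 1))) := by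
  -- both sides as A + B - 2C
  have hA : ∑ k ∈ range (n + 1), e k * log (μ k) = e 0 * log (e 0) + ∑ j ∈ range n, e (j + 1) * log (μ (j + 1)) := by
    rw [sum_range_succ', hμ0]; ring
  have hB : ∑ k ∈ range (n + 1), e k * log (μ (k + 1)) = (∑ j ∈ range n, e j * log (μ (j + 1))) + e n * log (e n) := by
    rw [sum_range_succ, hμn]
  have hC1 : ∑ k ∈ range (n + 1), e k * log (e k) = (∑ j ∈ range n, e j * log (e j)) + e n * log (e n) := sum_range_succ _ _
  have hC2 : ∑ k ∈ range (n + 1), e k * log (e k) = e 0 * log (e 0) + ∑ j ∈ range n, e (j + 1) * log (e (j + 1)) := by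
    rw [sum_range_succ']; ring
  have hV : ∀ j ∈ range n, (e j + e (j + 1)) * log (e j + e (j + 1)) =
      e j * log (μ (j + 1)) + e (j + 1) * log (μ (j + 1)) := by
    intro j hj
    rw [mem_range] at hj
    rw [hμ (j + 1) (by omega) (by omega), Nat.add_sub_cancel]; ring
  have hsplit : ∑ k ∈ range (n + 1), e k * (log (μ k) + log (μ (k + 1)) - 2 * log (e k)) =
      ∑ k ∈ range (n + 1), e k * log (μ k) + ∑ k ∈ range (n + 1), e k * log (μ (k + 1)) -
        (∑ k ∈ range (n + 1), e k * log (e k) + ∑ k ∈ range (n + 1), e k * log (e k)) := by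
    rw [← sum_add_distrib, ← sum_add_distrib, ← sum_sub_distrib]
    exact sum_congr rfl fun k _ => by ring
  have hR : ∑ j ∈ range n, ((e j + e (j + 1)) * log (e j + e (j + 1)) - e j * log (e j) - e (j + 1) * log (e (j + 1))) =
      ∑ j ∈ range n, e j * log (μ (j + 1)) + ∑ j ∈ range n, e (j + 1) * log (μ (j + 1)) -
        (∑ j ∈ range n, e j * log (e j) + ∑ j ∈ range n, e (j + 1) * log (e (j + 1))) := by
    rw [← sum_add_distrib, ← sum_add_distrib, ← sum_sub_distrib]
    exact sum_congr rfl fun j hj => by rw [hV j hj]; ring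
  rw [hsplit, hR, hA, hB]
  nth_rewrite 1 [hC1]
  rw [hC2]
  ring

end StaticTridiagonalRealUnit
end Summit.ValiantsHypothesis.ValiantsHypothesis.Theorems.KPlusLogSqLaw
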